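import Literature.AnabelianGeometry.EtaleTheta.Discharge.Sec2TemperedCoverDataModel
import Literature.AnabelianGeometry.EtaleTheta.Discharge.Sec2ThetaOrbitTransportCalculus
import Literature.AnabelianGeometry.EtaleTheta.Discharge.Sec2InnerInducesOnTheta
import HarnessLib

/-!
# [EtTh] Cor 2.8 (i), (iii) over the interface `ThetaOrbitData`: the named `Prop`s are SCHEMAS
# (instance-only facts) — kernel witnesses

`Literature/AnabelianGeometry/EtaleTheta/ThetaRootOrbits.lean` (cell `abc-iut`, seat abc-iut-L2-t2) types
S. Mochizuki, *The étale theta function …* [EtTh] §2, Cor. 2.8 (i) (constant multiple rigidity of the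
`l`-th roots of the étale theta class) and Cor. 2.8 (iii) (inner automorphisms act without constant
multiple), PRIMS text pp. 41–43, as `Prop`-valued definitions over the interface
`ThetaCovers.ThetaOrbitData T` (`T : ThetaCovers.TemperedCoverData l`).  There an orbit collection
(`etaZMu2`, `etaLZ`, …) is FREE DATA — an arbitrary set of sets of functions `Π^tp_Ÿ → Δ_Θ`, not required
to consist of cohomology classes — so the universally closed rows `∀ l T (O : ThetaOrbitData T), O.Cor28_i`
/ `O.Cor28_iii` are FALSE: at the cell's model `T` of `TemperedCoverData 3` (abc-iut-w5-d118,
`Discharge/Sec2TemperedCoverDataModel.lean`: `Π^tp_C = ((ℤ/3 × ℤ/3) ⋊ D₃ × ℤ/2) × ℤ`, `G_K = 1`) take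
`Δ_Θ :=` the centre `{(0,c)} ⋊ 1 ≅ ℤ/3`, the singleton "class" `{η₀}` of the indicator `η₀` of the rotation
`g = r ∈ Π^tp_Ÿ`, and the inner automorphism `γ_x`, `x = (1,0) ∈ Π^tp_{Ÿ̲̲}`: `γ_x` moves `η₀`
(`exists_orbitData_counterexample`, `not_forall_cor28_i`, `not_forall_cor28_iii`).  The two predicates:
`InducesOnTheta` holds at `(id, id)` for every `O` (abc-iut-f-152's `inducesOnTheta_refl`) but not universally
(`not_forall_inducesOnTheta`); `EqUpToRootOfUnity` is reflexive (abc-iut-L2-t2's `eqUpToRootOfUnity_refl`)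
but not universal (`not_forall_eqUpToRootOfUnity`).

| FACT row | decl | verdict | witness |
|---|---|---|---|
| F-0640 | `ThetaOrbitData.Cor28_i` | universal closure REFUTED; instance form = `ofEmbedding_cor28_i_inner` (L2) | `not_forall_cor28_i` |
| F-0641 | `ThetaOrbitData.Cor28_iii` | universal closure REFUTED; instance form = `ofEmbedding_cor28_iii_inner` (L2) | `not_forall_cor28_iii` |
| F-0642 | `ThetaOrbitData.EqUpToRootOfUnity` (predicate) | closure REFUTED; positive instance `eqUpToRootOfUnity_refl` | `not_forall_eqUpToRootOfUnity` |
| F-0643 | `ThetaOrbitData.InducesOnTheta` (predicate) | closure REFUTED; positive instance `inducesOnTheta_refl` (f-152) | `not_forall_inducesOnTheta` |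

What a refutation here MEANS: only the logical shape of the interface rows (consumable AT A NAMED `O` —
e.g. abc-iut-L2-t2's `ofEmbedding`, where the collections ARE cohomology classes and the inner clauses are
the theorems `ofEmbedding_cor28_i_inner` / `ofEmbedding_cor28_iii_inner` — never as `∀ O`); nothing about
[EtTh] (a refereed paper).  Cell `abc-iut`, seat abc-iut-w4-d051 (F-TRANCHES 151/152, D-0078 (S1)).  No
bearing on [IUTchIII] Cor. 3.12; no side taken; typed ≠ proved.  Proof-only: no definitions, no instances.

## References

* [MochizukiEtTh2009] S. Mochizuki, *The étale theta function and its Frobenioid-theoretic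
  manifestations*, Publ. RIMS 45 (2009): Def. 2.7 p.41, Cor. 2.8 (i), (iii) p.42 (PRIMS text pages).
-/

noncomputable section

open scoped Classical

namespace Literature.AnabelianGeometry.EtaleTheta

namespace ThetaCovers

namespace ThetaOrbitData

universe u

/-! ## §1. Generic facts over an arbitrary `T : TemperedCoverData l` -/

section generic

variable {l : ℕ} {T : TemperedCoverData.{u} l}

/-- An inner automorphism `γ_x` of `Π^tp_C` stabilises every subgroup containing `x`.
[cite: MochizukiEtTh2009, Cor 2.8(iii) p.42] -/
theorem map_innerAutTop_of_mem {S : Subgroup T.Gtp} {x : T.Gtp} (hx : x ∈ S) :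
    S.map (innerAutTop x).toMulEquiv.toMonoidHom = S := by
  ext y
  constructor
  · rintro ⟨z, hz, rfl⟩
    exact S.mul_mem (S.mul_mem hx hz) (S.inv_mem hx)
  · intro hy
    refine ⟨x⁻¹ * y * x, S.mul_mem (S.mul_mem (S.inv_mem hx) hy) hx, ?_⟩
    show x * (x⁻¹ * y * x) * x⁻¹ = y
    group

/-- **The counterexample, generically.**  Let `T` be any `TemperedCoverData l` with FINITE `G_K`, `Z ⊴ Π^tp_C`
a commutative normal subgroup inside `Π^tp_Ÿ ∩ Δ` containing an element `t` with `t² ≠ 1`, `x ∈ Π^tp_Ÿ ∩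
Π^tp_{X̲̲} ∩ Π^tp_Ċ` centralising `Z`, and `g ∈ Π^tp_Ÿ ∩ Δ` NOT commuting with `x`.  Then the orbit datum
`O` with `Δ_Θ := Z/1`, `Dtau := {1}` and every orbit collection the singleton "class" `{η₀}`, `η₀ :=`
the indicator function of `g` with value `t`, is of standard type and VIOLATES the typed `Cor28_i`
(clause `η̈^{Θ,ℤ×μ₂}`, order `1`, for `γ = γ_x`) and `Cor28_iii` (clause `η̈^{Θ,l·ℤ}` for `x ∈ Π^tp_{Ẋ̲}`),
and exhibits the non-universality of the two predicates. [cite: MochizukiEtTh2009, Cor 2.8(i) p.42] -/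
theorem exists_orbitData_counterexample [Finite T.GK]
    (Z : Subgroup T.Gtp) (hZn : Z.Normal) (hZle : Z ≤ T.PiYddtp ⊓ (T.aug.comp T.toHat).ker)
    (hZc : ∀ a ∈ Z, ∀ b ∈ Z, a * b = b * a)
    {t : T.Gtp} (ht : t ∈ Z) (ht2 : t * t ≠ 1)
    {x : T.Gtp} (hxY : x ∈ T.PiYddtp) (hxU : x ∈ T.tp T.PiXuu) (hxD : x ∈ T.PiCdot)
    (hxZ : ∀ z ∈ Z, x * z * x⁻¹ = z)
    {g : T.Gtp} (hgY : g ∈ T.PiYddtp) (hg1 : T.aug (T.toHat g) = 1) (hxg : x * g ≠ g * x) :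
    ∃ O : ThetaOrbitData T, O.IsStandard ∧ ¬ O.Cor28_i ∧ ¬ O.Cor28_iii ∧
      (∃ ΓΘ : O.DeltaTheta ≃* O.DeltaTheta, ¬ O.InducesOnTheta (ContinuousMulEquiv.refl T.Gtp) ΓΘ) ∧
      ∀ (n : ℕ) (H : Subgroup T.Gtp), ∃ C C', ¬ O.EqUpToRootOfUnity n H C C' := by
  classical
  haveI := hZn
  -- basic consequences of the hypotheses
  have hg_ne : g ≠ 1 := by rintro rfl; exact hxg (by rw [mul_one, one_mul])
  have hxgx : x * g * x⁻¹ ≠ g := fun h => hxg (mul_inv_eq_iff_eq_mul.mp h)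
  have hg₂ : x⁻¹ * g * x ≠ g := fun h => hxg (calc x * g = x * (x⁻¹ * g * x) := by rw [h]
      _ = g * x := by group)
  have hg₂Y : x⁻¹ * g * x ∈ T.PiYddtp := T.PiYddtp.mul_mem (T.PiYddtp.mul_mem (T.PiYddtp.inv_mem hxY) hgY) hxY
  have hxgY : x * g * x⁻¹ ∈ T.PiYddtp := T.PiYddtp.mul_mem (T.PiYddtp.mul_mem hxY hgY) (T.PiYddtp.inv_mem hxY)
  have hxg₂Y : x * (x⁻¹ * g * x) * x⁻¹ ∈ T.PiYddtp :=
    T.PiYddtp.mul_mem (T.PiYddtp.mul_mem hxY hg₂Y) (T.PiYddtp.inv_mem hxY)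
  -- the coefficient module `Z/1` and the value `tq`
  let tq : ↥Z ⧸ (⊥ : Subgroup T.Gtp).subgroupOf Z := QuotientGroup.mk ⟨t, ht⟩
  have hmk_inj : ∀ a b : ↥Z, (QuotientGroup.mk a : ↥Z ⧸ (⊥ : Subgroup T.Gtp).subgroupOf Z) =
      QuotientGroup.mk b → a = b := fun a b h => Subtype.ext (by
    rwa [QuotientGroup.eq, Subgroup.mem_subgroupOf, Subgroup.mem_bot, Subgroup.coe_mul,
      Subgroup.coe_inv, inv_mul_eq_one] at h)
  have htq1 : tq ≠ 1 := fun h => ht2 (by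
    have htt : t = 1 := congrArg Subtype.val (hmk_inj ⟨t, ht⟩ 1 (by rw [QuotientGroup.mk_one]; exact h))
    rw [htt, mul_one])
  have htq2 : tq * tq ≠ 1 := fun h => ht2 (congrArg Subtype.val
    (hmk_inj (⟨t, ht⟩ * ⟨t, ht⟩) 1 (by rw [QuotientGroup.mk_mul, QuotientGroup.mk_one]; exact h)))
  -- the "class": the indicator of `g` with value `tq`
  let η₀ : ↥T.PiYddtp → ↥Z ⧸ (⊥ : Subgroup T.Gtp).subgroupOf Z := fun y => if (y : T.Gtp) = g then tq else 1
  have hη₀_of_eq : ∀ y : ↥T.PiYddtp, (y : T.Gtp) = g → η₀ y = tq := fun y hy => if_pos hy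
  have hη₀_of_ne : ∀ y : ↥T.PiYddtp, (y : T.Gtp) ≠ g → η₀ y = 1 := fun y hy => if_neg hy
  -- the orbit datum
  let O : ThetaOrbitData T :=
    { top := Z
      bot := ⊥
      bot_le := _root_.bot_le
      top_normal := hZn
      bot_normal := inferInstance
      top_le := hZle
      Dtau := {⊥}
      Dtau_le := fun D hD => by rw [Set.mem_singleton_iff.mp hD]; exact _root_.bot_le
      Dtau_nonempty := Set.singleton_nonempty _
      Dtau_aug := fun D hD => by
        rw [Set.mem_singleton_iff.mp hD, Subgroup.map_bot]
        refine ⟨fun a ha b hb _ => ?_, inferInstance⟩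
        rw [SetLike.mem_coe, Subgroup.mem_bot] at ha hb
        rw [ha, hb]
      etaZMu2 := {{η₀}}
      etaLZMu2 := {{η₀}}
      etaLZ := {{η₀}}
      etaLZ_sub := ⟨subset_rfl, subset_rfl⟩
      rootLZMu2 := ∅
      rootLZ := ∅
      rootLZ_sub := Set.empty_subset _
      root_pow := fun c hc => absurd hc (Set.notMem_empty c) }
  -- `act 1` is the identity on `Δ_Θ`
  have hact1 : ∀ q : O.DeltaTheta, O.act 1 q = q := fun q => by
    induction q using QuotientGroup.induction_on with
    | H z => rw [act_mk]; congr 1; exact Subtype.ext (by show (1 : T.Gtp) * z * 1⁻¹ = z; group)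
  -- the standard-type hypothesis holds
  have hstd : O.IsStandard := by
    refine ⟨⊥, Set.mem_singleton _, {η₀}, Set.mem_singleton _, η₀, Set.mem_singleton _, 1, fun y hy => ?_⟩
    obtain rfl : y = 1 := Subgroup.mem_bot.mp hy
    rw [hη₀_of_ne _ (fun h => hg_ne h.symm), one_pow, hact1, mul_inv_cancel]
  -- the inner automorphism `γ_x` induces the identity on `Δ_Θ = Z/1` (`x` centralises `Z`)
  have hind : O.InducesOnTheta (innerAutTop x) (MulEquiv.refl _) :=
    ⟨map_innerAutTop_eq_of_normal Z x, fun d => by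
      show QuotientGroup.mk d = QuotientGroup.mk _
      congr 1
      exact Subtype.ext (hxZ d d.2).symm⟩
  have hY : T.PiYddtp.map (innerAutTop x).toMulEquiv.toMonoidHom = T.PiYddtp := map_innerAutTop_of_mem hxY
  have hYuu : (T.PiYddtp ⊓ T.tp T.PiXuu).map (innerAutTop x).toMulEquiv.toMonoidHom = T.PiYddtp ⊓ T.tp T.PiXuu :=
    map_innerAutTop_of_mem ⟨hxY, hxU⟩
  have hxu : x ∈ T.tp T.PiXu := Subgroup.mem_comap.mpr (Subgroup.mem_sup_left (Subgroup.mem_comap.mp hxU))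
  have hxX : x ∈ T.tp T.PiX := T.PiYtp_le (T.PiYddtp_le hxY)
  -- the transported class `γ_x · η₀` is the indicator of `x⁻¹ g x`: its values at `g` and at `x⁻¹ g x`
  have ev1 : (fun g' : ↥T.PiYddtp => (MulEquiv.refl O.DeltaTheta).symm
      (η₀ ⟨(innerAutTop x) g', hY.le (Subgroup.mem_map.mpr ⟨g', g'.2, rfl⟩)⟩)) ⟨g, hgY⟩ = 1 :=
    hη₀_of_ne ⟨x * g * x⁻¹, hxgY⟩ hxgx
  have ev2 : (fun g' : ↥T.PiYddtp => (MulEquiv.refl O.DeltaTheta).symm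
      (η₀ ⟨(innerAutTop x) g', hY.le (Subgroup.mem_map.mpr ⟨g', g'.2, rfl⟩)⟩)) ⟨x⁻¹ * g * x, hg₂Y⟩ = tq :=
    hη₀_of_eq ⟨x * (x⁻¹ * g * x) * x⁻¹, hxg₂Y⟩ (by group)
  have transport_singleton :
      O.transport T.PiYddtp (innerAutTop x) hY (MulEquiv.refl _) {{η₀}} =
        {{fun g' : ↥T.PiYddtp => (MulEquiv.refl O.DeltaTheta).symm
          (η₀ ⟨(innerAutTop x) g', hY.le (Subgroup.mem_map.mpr ⟨g', g'.2, rfl⟩)⟩)}} := by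
    simp only [ThetaOrbitData.transport, Set.image_singleton]
  refine ⟨O, hstd, ?_, ?_, ?_, ?_⟩
  · -- ¬ Cor28_i : clause `η̈^{Θ,ℤ×μ₂}` of order `1` for `γ = γ_x`
    intro h
    have hDtau : ∀ D ∈ O.Dtau, D.map (innerAutTop x).toMulEquiv.toMonoidHom ∈ O.Dtau := fun D hD => by
      rw [(Set.mem_singleton_iff.mp hD : D = ⊥), Subgroup.map_bot]
      exact Set.mem_singleton _
    obtain ⟨-, -, hc, -⟩ := h hstd (innerAutTop x) (MulEquiv.refl _) hind hDtau hY hYuu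
    have hant : ∀ S ∈ [T.tp T.PiXu, T.tp T.PiX, T.PiYddtp],
        S.map (innerAutTop x).toMulEquiv.toMonoidHom = S := fun S hS => by
      simp only [List.mem_cons, List.not_mem_nil, or_false] at hS
      rcases hS with rfl | rfl | rfl
      · exact map_innerAutTop_of_mem hxu
      · exact map_innerAutTop_of_mem hxX
      · exact hY
    obtain ⟨κ, hκi, -, -, hC⟩ := hc hant
    change O.transport T.PiYddtp (innerAutTop x) hY (MulEquiv.refl _) {{η₀}} = O.twist _ κ {{η₀}} at hC
    rw [transport_singleton] at hC
    simp only [ThetaOrbitData.twist, Set.image_singleton, Set.singleton_eq_singleton_iff] at hC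
    -- hC : (transported η₀) = fun g' => η₀ g' * κ g' ; evaluate at `g` and at `x⁻¹ g x`
    have h1 : (1 : O.DeltaTheta) = η₀ ⟨g, hgY⟩ * κ g := ev1.symm.trans (congrFun hC ⟨g, hgY⟩)
    have h2 : tq = η₀ ⟨x⁻¹ * g * x, hg₂Y⟩ * κ (x⁻¹ * g * x) := ev2.symm.trans (congrFun hC ⟨_, hg₂Y⟩)
    -- `κ` is inflated from `G_K`: `κ (x⁻¹ g x) = κ g`
    rw [hη₀_of_ne ⟨x⁻¹ * g * x, hg₂Y⟩ hg₂, one_mul,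
      hκi _ g (by simp only [map_mul, map_inv, hg1, mul_one, inv_mul_cancel])] at h2
    rw [hη₀_of_eq ⟨g, hgY⟩ rfl, ← h2] at h1
    exact htq2 h1.symm
  · -- ¬ Cor28_iii : clause `η̈^{Θ,l·ℤ}` for `x ∈ Π^tp_{X̲} ∩ Π^tp_Ċ`
    intro h
    obtain ⟨-, hcl, -, -⟩ := h x (MulEquiv.refl _) hind hY hYuu
    have hC := hcl ⟨hxu, hxD⟩
    change O.transport T.PiYddtp (innerAutTop x) hY (MulEquiv.refl _) {{η₀}} = {{η₀}} at hC
    rw [transport_singleton, Set.singleton_eq_singleton_iff, Set.singleton_eq_singleton_iff] at hC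
    have h1 : (1 : O.DeltaTheta) = η₀ ⟨g, hgY⟩ := ev1.symm.trans (congrFun hC ⟨g, hgY⟩)
    rw [hη₀_of_eq ⟨g, hgY⟩ rfl] at h1
    exact htq1 h1.symm
  · -- the predicate `InducesOnTheta` fails at `(id, inversion)`
    have hcomm : ∀ a b : O.DeltaTheta, a * b = b * a := fun a b => by
      induction a using QuotientGroup.induction_on with
      | H a =>
        induction b using QuotientGroup.induction_on with
        | H b => rw [← QuotientGroup.mk_mul, ← QuotientGroup.mk_mul]; exact congrArg _ (Subtype.ext (hZc a a.2 b b.2))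
    let ι : O.DeltaTheta ≃* O.DeltaTheta :=
      { toFun := fun q => q⁻¹
        invFun := fun q => q⁻¹
        left_inv := fun q => inv_inv q
        right_inv := fun q => inv_inv q
        map_mul' := fun a b => by rw [mul_inv_rev, hcomm] }
    refine ⟨ι, fun ⟨hΓ, hι⟩ => htq2 ?_⟩
    have h' : tq⁻¹ = tq := hι ⟨t, ht⟩
    calc tq * tq = tq⁻¹ * tq := by rw [h']
      _ = 1 := inv_mul_cancel tq
  · -- the predicate `EqUpToRootOfUnity` fails at `(∅, {∅})`
    refine fun n H => ⟨∅, {∅}, fun ⟨κ, _, _, _, hC⟩ => (Set.singleton_nonempty (∅ : Set (↥H → O.DeltaTheta))).ne_empty ?_⟩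
    simpa only [ThetaOrbitData.twist, Set.image_empty] using hC

end generic

/-! ## §2. The closed instance: abc-iut-w5-d118's model of `TemperedCoverData 3` -/

section model

open Multiplicative HeisenbergWitness TemperedModel Literature.AnabelianGeometry.EtaleTheta.SettingModel

/-- In the Heisenberg toy `(ℤ/3 × ℤ/3) ⋊ D₃`: the `c`-coordinates of `(1,0)·r` and `r·(1,0)` differ
(`0 ≠ 1`), so `(1,0)` and the rotation `r` do not commute. (toy bookkeeping)
[cite: MochizukiEtTh2009, Def 2.1 p.36] -/
theorem model_gamma_comm_ne :
    HeisenbergWitness.γ 3 ((SemidirectProduct.inl (ofAdd ((1 : ZMod 3), (0 : ZMod 3))) : heisPiC 3) *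
        SemidirectProduct.inr (DihedralGroup.r 1)) ≠
      HeisenbergWitness.γ 3 ((SemidirectProduct.inr (DihedralGroup.r 1) : heisPiC 3) *
        SemidirectProduct.inl (ofAdd ((1 : ZMod 3), (0 : ZMod 3)))) := by
  decide

/-- In the Heisenberg toy: the central element `(0,1)` has `(0,1)² = (0,2) ≠ 1` (`c`-coordinate `2 ≠ 0`).
(toy bookkeeping) [cite: MochizukiEtTh2009, Def 2.1 p.36] -/
theorem model_gamma_sq_ne :
    HeisenbergWitness.γ 3 ((thetaEmb 3 (ofAdd 1) : heisPiC 3) * thetaEmb 3 (ofAdd 1)) ≠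
      HeisenbergWitness.γ 3 (1 : heisPiC 3) := by
  decide

/-- **The closed counterexample.**  At abc-iut-w5-d118's model `T` of `ThetaCovers.TemperedCoverData 3`
(`Π^tp_C = ((ℤ/3 × ℤ/3) ⋊ D₃ × ℤ/2) × ℤ`, `G_K = 1`; the structure literal of
`Discharge/Sec2TemperedCoverDataModel.lean`, re-assembled from its public lemmas) there is an orbit datum
`O : ThetaOrbitData T` — of standard type — violating the typed `Cor28_i` and `Cor28_iii`, at which the
predicates `InducesOnTheta (id, ·)` and `EqUpToRootOfUnity` are not universally true.
[cite: MochizukiEtTh2009, Cor 2.8(i) p.42] -/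
theorem exists_model_counterexample :
    ∃ (T : TemperedCoverData.{0} 3) (O : ThetaOrbitData T), O.IsStandard ∧ ¬ O.Cor28_i ∧ ¬ O.Cor28_iii ∧
      (∃ ΓΘ : O.DeltaTheta ≃* O.DeltaTheta, ¬ O.InducesOnTheta (ContinuousMulEquiv.refl T.Gtp) ΓΘ) ∧
      ∀ (n : ℕ) (H : Subgroup T.Gtp), ∃ C C', ¬ O.EqUpToRootOfUnity n H C C' := by
  have hl : Odd 3 := ⟨1, rfl⟩
  haveI := TAX_normal 3
  haveI : ((TAX 3).prod (⊥ : Subgroup (Multiplicative ℤ))).Normal := Subgroup.prod_normal _ _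
  -- abc-iut-w5-d118's inhabitant (`Discharge/Sec2TemperedCoverDataModel.lean`, `exists_model`), verbatim
  let T : TemperedCoverData.{0} 3 :=
    { toCoverDataAx := coverDataAx 3 hl
      PiCuu := PiCuuM 3
      isTypeLTorsThetaPm := isTypeLTorsThetaPm_PiCuuM 3 hl
      isOpen_PiCuu' := isOpen_PiCuuM 3
      Gtp := GtpM 3
      toHat := (toHatM 3).toMonoidHom
      continuous_toHat := (toHatM 3).continuous
      injective_toHat := toHatM_injective 3
      isProfiniteCompletion_toHat := isProfiniteCompletion_prodMap_etaCont (TA 3) (Multiplicative ℤ)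
      PiYtp := (TAX 3).prod ⊥
      PiYtp_le := by
        change (TAX 3).prod ⊥ ≤ (PiXM 3).comap (toHatM 3).toMonoidHom
        rw [comap_toHatM_PiXM]
        exact Subgroup.prod_mono le_rfl _root_.bot_le
      PiYtp_normal := inferInstance
      isOpen_PiYtp := isOpen_discrete _
      quotZ := nonempty_quotZ 3
      PiYddtp := ((TAX 3 ⊓ (TA.two 3).ker)).prod ⊥
      PiYddtp_le := Subgroup.prod_mono inf_le_left le_rfl
      isOpen_PiYddtp := isOpen_discrete _
      relIndex_PiYddtp := relIndex_PiYddtp 3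
      PiCdot := ((TA.two 3).ker).prod ⊤
      index_PiCdot := index_PiCdot 3
      isOpen_PiCdot := isOpen_discrete _
      PiCdot_ne := PiCdot_ne 3 }
  haveI : Finite T.GK := inferInstanceAs (Finite PUnit)
  let a0 : Multiplicative (ZMod 3 × ZMod 3) := ofAdd ((1 : ZMod 3), (0 : ZMod 3))  -- `(1,0)`
  let t : GtpM 3 := (TA.mk 3 (thetaEmb 3 (ofAdd 1)) 1, 1)
  let x : GtpM 3 := (TA.mk 3 (SemidirectProduct.inl a0) 1, 1)
  let g : GtpM 3 := (TA.mk 3 (SemidirectProduct.inr (DihedralGroup.r 1)) 1, 1)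
  -- `Δ_Θ`-preimage: the centre `{(0,c)} ⋊ 1` of the Heisenberg factor
  let Z : Subgroup (GtpM 3) := ((heisTheta 3).comap (TA.heis 3) ⊓ (TA.two 3).ker).prod ⊥
  have hZn : Z.Normal := by
    haveI h1 : ((heisTheta 3).comap (TA.heis 3)).Normal := Subgroup.Normal.comap (heisTheta_normal 3) _
    haveI h2 : ((heisTheta 3).comap (TA.heis 3) ⊓ (TA.two 3).ker).Normal := inferInstance
    exact Subgroup.prod_normal _ _
  have hinlX : (SemidirectProduct.inl a0 : heisPiC 3) ∈ heisPiX 3 :=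
    (mem_heisPiX 3).mpr ⟨0, by rw [SemidirectProduct.right_inl, DihedralGroup.one_def]⟩
  have hZle : Z ≤ T.PiYddtp ⊓ (T.aug.comp T.toHat).ker := le_inf
    (Subgroup.prod_mono (inf_le_inf_right _ (Subgroup.comap_mono (heisTheta_le_heisPiX 3))) le_rfl)
    fun _ _ => rfl
  have hrange : ∀ a ∈ Z, TA.heis 3 a.1 ∈ (thetaEmb 3).range := fun a ha => by
    rw [← heisTheta_eq_range]; exact (Subgroup.mem_inf.mp (Subgroup.mem_prod.mp ha).1).1
  have hZc : ∀ a ∈ Z, ∀ b ∈ Z, a * b = b * a := by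
    intro a ha b hb
    obtain ⟨u, hu⟩ := hrange a ha
    obtain ⟨v, hv⟩ := hrange b hb
    refine Prod.ext (Prod.ext ?_ (mul_comm _ _)) (mul_comm _ _)
    change TA.heis 3 a.1 * TA.heis 3 b.1 = TA.heis 3 b.1 * TA.heis 3 a.1
    rw [← hu, ← hv, ← map_mul, ← map_mul, mul_comm]
  have ht : t ∈ Z := by
    refine Subgroup.mem_prod.mpr ⟨Subgroup.mem_inf.mpr ⟨?_, rfl⟩, Subgroup.mem_bot.mpr rfl⟩
    show thetaEmb 3 (ofAdd 1) ∈ heisTheta 3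
    exact heisTheta_eq_range 3 ▸ ⟨_, rfl⟩
  have ht2 : t * t ≠ 1 := fun h =>
    model_gamma_sq_ne (congrArg (fun p : GtpM 3 => HeisenbergWitness.γ 3 (TA.heis 3 p.1)) h)
  have hxY : x ∈ T.PiYddtp := by
    change x ∈ ((TAX 3 ⊓ (TA.two 3).ker)).prod ⊥
    exact Subgroup.mem_prod.mpr ⟨Subgroup.mem_inf.mpr ⟨hinlX, rfl⟩, Subgroup.mem_bot.mpr rfl⟩
  have hXM : toHatM 3 x ∈ PiXM 3 := (mem_comap_toHatM_PiXM 3 x).mpr hinlX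
  have hxU : x ∈ T.tp T.PiXuu := by
    change toHatM 3 x ∈ PiCuuM 3 ⊓ PiXM 3
    refine Subgroup.mem_inf.mpr ⟨?_, hXM⟩
    refine Subgroup.mem_sup_left (Subgroup.mem_sup_right ?_)
    refine Subgroup.mem_inf.mpr ⟨Subgroup.mem_inf.mpr ⟨?_, hXM⟩, ?_⟩
    · show Phi 3 (toHatM 3 x) ∈ heisPiCu 3
      rw [toHatM_apply, Phi_eta]
      exact Or.inl rfl
    · rw [MonoidHom.mem_ker, toHatM_apply, Psi_eta, toAdd_one, Int.cast_zero, ofAdd_zero]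
  have hxD : x ∈ T.PiCdot := by
    change x ∈ ((TA.two 3).ker).prod ⊤
    exact Subgroup.mem_prod.mpr ⟨rfl, Subgroup.mem_top _⟩
  have hxZ : ∀ z ∈ Z, x * z * x⁻¹ = z := by
    intro z hz
    rw [mul_inv_eq_iff_eq_mul]
    have e : TA.heis 3 z.1 * SemidirectProduct.inl a0 = SemidirectProduct.inl a0 * TA.heis 3 z.1 :=
      mul_inv_eq_iff_eq_mul.mp (mul_inv_eq_one.mp
        (heis_central 3 hl (Subgroup.mem_inf.mp (Subgroup.mem_prod.mp hz).1).1 hinlX))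
    refine Prod.ext (Prod.ext ?_ (mul_comm _ _)) (mul_comm _ _)
    change SemidirectProduct.inl a0 * TA.heis 3 z.1 = TA.heis 3 z.1 * SemidirectProduct.inl a0
    exact e.symm
  have hgY : g ∈ T.PiYddtp := by
    change g ∈ ((TAX 3 ⊓ (TA.two 3).ker)).prod ⊥
    refine Subgroup.mem_prod.mpr ⟨Subgroup.mem_inf.mpr ⟨?_, rfl⟩, Subgroup.mem_bot.mpr rfl⟩
    exact (mem_heisPiX 3).mpr ⟨1, rfl⟩
  have hg1 : T.aug (T.toHat g) = 1 := rfl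
  have hxg : x * g ≠ g * x := fun h =>
    model_gamma_comm_ne (congrArg (fun p : GtpM 3 => HeisenbergWitness.γ 3 (TA.heis 3 p.1)) h)
  obtain ⟨O, hO⟩ := exists_orbitData_counterexample (T := T) Z hZn hZle hZc ht ht2 hxY hxU hxD hxZ hgY hg1 hxg
  exact ⟨T, O, hO⟩

/-- **FACT row F-0640 (`ThetaOrbitData.Cor28_i`, [EtTh] Cor 2.8 (i)) is a SCHEMA**: its universal closure over
the interface is false (consume it at a NAMED orbit datum only, e.g. abc-iut-L2-t2's `ofEmbedding`, where the
inner case is the theorem `ofEmbedding_cor28_i_inner`). [cite: MochizukiEtTh2009, Cor 2.8(i) p.42] -/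
theorem not_forall_cor28_i :
    ¬ ∀ (l : ℕ) (T : TemperedCoverData.{0} l) (O : ThetaOrbitData T), O.Cor28_i := by
  obtain ⟨T, O, -, h, -⟩ := exists_model_counterexample
  exact fun H => h (H 3 T O)

/-- **FACT row F-0641 (`ThetaOrbitData.Cor28_iii`, [EtTh] Cor 2.8 (iii)) is a SCHEMA**: its universal closure
over the interface is false (instance form: abc-iut-L2-t2's `ofEmbedding_cor28_iii_inner`).
[cite: MochizukiEtTh2009, Cor 2.8(iii) p.42] -/
theorem not_forall_cor28_iii :
    ¬ ∀ (l : ℕ) (T : TemperedCoverData.{0} l) (O : ThetaOrbitData T), O.Cor28_iii := by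
  obtain ⟨T, O, -, -, h, -⟩ := exists_model_counterexample
  exact fun H => h (H 3 T O)

/-- **FACT row F-0643 (`ThetaOrbitData.InducesOnTheta`) is a PREDICATE**: its universal closure is false
(positive instance: abc-iut-f-152's `inducesOnTheta_refl`). [cite: MochizukiEtTh2009, Cor 2.8(i) p.42] -/
theorem not_forall_inducesOnTheta :
    ¬ ∀ (l : ℕ) (T : TemperedCoverData.{0} l) (O : ThetaOrbitData T) (Γ : T.Gtp ≃ₜ* T.Gtp)
      (ΓΘ : O.DeltaTheta ≃* O.DeltaTheta), O.InducesOnTheta Γ ΓΘ := by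
  obtain ⟨T, O, -, -, -, ⟨ΓΘ, h⟩, -⟩ := exists_model_counterexample
  exact fun H => h (H 3 T O _ ΓΘ)

/-- **FACT row F-0642 (`ThetaOrbitData.EqUpToRootOfUnity`) is a PREDICATE**: its universal closure is false
(positive instance: abc-iut-L2-t2's `eqUpToRootOfUnity_refl`). [cite: MochizukiEtTh2009, Cor 2.8(i) p.42] -/
theorem not_forall_eqUpToRootOfUnity :
    ¬ ∀ (l : ℕ) (T : TemperedCoverData.{0} l) (O : ThetaOrbitData T) (n : ℕ) (H : Subgroup T.Gtp)
      (C C' : Set (Set (↥H → O.DeltaTheta))), O.EqUpToRootOfUnity n H C C' := by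
  obtain ⟨T, O, -, -, -, -, h⟩ := exists_model_counterexample
  obtain ⟨C, C', hC⟩ := h 1 ⊤
  exact fun H => hC (H 3 T O 1 ⊤ C C')

end model

end ThetaOrbitData

end ThetaCovers

end Literature.AnabelianGeometry.EtaleTheta
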